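import Summits.AtomisticToContinuum.FouriersLaw.Theorems.VanishingNoiseTransferNoiseLocalityStubDuhamelFlipBound

/-!
# Stub `stub_responseContinuousInNoise` of crux `NoiseLocality` (line `fekete-transposed-uniformity`),
part 1: the Duhamel identity in the flip Dirichlet form between TWO flip rates

Helper file `--supports stmt-AtomisticToContinuum-11975` (crux `VanishingNoiseTransfer.NoiseLocality`, route
`VanishingNoiseTransfer`, line `fekete-transposed-uniformity`, stub 2 `stub_responseContinuousInNoise`: the
fixed-`N` linear response is continuous in the flip rate on `[0,1]`).

**Theorem (`abs_sub_le_of_weak_two`, registered form `helper_duhamelFlipBoundTwoRates`).** Pinned anharmonic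
chain `pinnedChain ω₂ lam β γ` (all parameters `> 0`) between Langevin baths, `T > 0`, any length `N`, any
two flip rates `ε, ε'` (real; no sign is used). Let `με, με'` be the unique weak steady families of `L + εS`,
`L + ε'S` (`S` the velocity-flip generator), `Uε, Uε'` response densities of the two families at `T` and
`Dε, Dε'` the response coefficients. Then
`|Dε − Dε'| ≤ |ε − ε'| (N−1) T² √𝓔_f(Uε) √𝓔_f(Uε')`, `𝓔_f(U) = ½ ∑_i ∫ (U − U∘Θ_i)² dμ_T` — the
two-positive-rates generalisation of the landed `stub_duhamelFlipBound` (which is the case `ε' = 0`), used by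
the stub for the local Lipschitz continuity of `ε ↦ D_N(ε)` on `(0,1]`.

Proof (`N ≥ 2`; for `N ≤ 1` the total current vanishes identically). With `μ_T` the Gibbs measure,
`J = ∑_i j_i`, `φ = γ(p_0² − p_{N−1}²)/(2T²)`, `c = (N−1)T²`: (1) `D = ∫ J U dμ_T` (`responseCoeff_eq`) and the
weak adjoint equations `∫ (LF + εSF) Uε = −∫ F φ`, `∫ (LF + ε'SF) Uε' = −∫ F φ` for `F ∈ C_c^∞`
(`integral_flipGenerator_mul_responseDensity_gibbs`), i.e. `∫ (LF) U = −∫ Fφ − r ∫ F (S U)` at rate `r` (`S`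
symmetric); (2) for `W = Uε − Uε'`: `∫ (LF) W = ∫ F w₂`, `w₂ = −ε S Uε + ε' S Uε'`; (3) the graph-closure theorem
`integral_eq_of_weak_pair` at the weak pair `(Ψ, LΨ)` (`Ψ` the flip-invariant McLennan potential,
`LΨ = c⁻¹J + φ`, `SΨ = 0`) gives `c⁻¹∫ J W + ∫ φ W = ∫ Ψ w₂ = 0`; at the weak pair
`(Uε'∘Θ, −φ − ε'(S Uε')∘Θ)` (which is (1) at rate `ε'` read through `L† = ΘLΘ`) it gives, with `S∘Θ = Θ∘S` and
the symmetry of `S`, `∫ φ W = (ε − ε') ∫ (Uε'∘Θ)(S Uε)`; (4) hence `Dε − Dε' = −c(ε − ε') ∫ (Uε'∘Θ)(S Uε) dμ_T`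
and Cauchy–Schwarz in the flip form plus the `Θ`-invariance of the flip energy give the bound. No definitions.
-/

noncomputable section

open MeasureTheory Filter Topology
open scoped ContDiff

namespace Summit.AtomisticToContinuum.FouriersLaw.Theorems.NoiseLocality

open Literature.MathematicalPhysics.KineticTheory.HeatConduction
open Summit.AtomisticToContinuum.FouriersLaw.Theorems.OddSectorIrreversibility
open Summit.AtomisticToContinuum.FouriersLaw.Theorems.NoiseLocality.StubResponseDensityNoisy
open Summit.AtomisticToContinuum.FouriersLaw.Theorems.NoiseLocality.StubDuhamelFlipBound
open Literature.Barriers.AtomisticToContinuum.OpenChain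

namespace StubResponseContinuousInNoise

variable {N : ℕ}

/-- `S` is linear: `S (U − U') = S U − S U'` pointwise. [folklore] -/
theorem flipNoise_sub (U U' : PhaseSpace N → ℝ) (x : PhaseSpace N) :
    flipNoise N (fun y => U y - U' y) x = flipNoise N U x - flipNoise N U' x := by
  simp only [flipNoise_eq, ← Finset.sum_sub_distrib]
  exact Finset.sum_congr rfl fun i _ => by ring

/-- `S` commutes with the momentum reversal `Θ(q,p) = (q,-p)`: `S (U ∘ Θ) = (S U) ∘ Θ`
(`Θ ∘ Θ_i = Θ_i ∘ Θ`). [folklore] -/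
theorem flipNoise_comp_reversal (U : PhaseSpace N → ℝ) (x : PhaseSpace N) :
    flipNoise N (fun y : PhaseSpace N => U (y.1, -y.2)) x = flipNoise N U (x.1, -x.2) := by
  simp only [flipNoise_eq]
  refine Finset.sum_congr rfl fun i _ => ?_
  rw [reversal_momentumFlip i x]

variable {ω₂ lam β γ : ℝ} {T : ℝ}

/-- **The Duhamel identity and bound between two flip rates, main case `N ≥ 2`**, with the response
densities already in hand: if `U, U' ∈ L²(μ_T)` satisfy the weak adjoint equations
`∫ (L F + ε S F) U dμ_T = −∫ F φ dμ_T` and `∫ (L F + ε' S F) U' dμ_T = −∫ F φ dμ_T` for all test `F`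
(`φ` the McLennan source), then `|∫ J U dμ_T − ∫ J U' dμ_T| ≤ |ε − ε'| (N−1) T² √𝓔_f(U) √𝓔_f(U')`.
See the module docstring. -/
theorem abs_sub_le_of_weak_two (hω : 0 < ω₂) (hl : 0 ≤ lam) (hβ : 0 < β) (hγ : 0 < γ) (hN : 2 ≤ N)
    (hT : 0 < T) (ε ε' : ℝ) {U U' : PhaseSpace N → ℝ}
    (hUm : MemLp U 2 ((pinnedChain ω₂ lam β γ).gibbsMeasure N T))
    (hU'm : MemLp U' 2 ((pinnedChain ω₂ lam β γ).gibbsMeasure N T))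
    (hE : ∀ F : PhaseSpace N → ℝ, ContDiff ℝ ∞ F → HasCompactSupport F →
      ∫ x, (pinnedChain ω₂ lam β γ).flipGenerator N T T ε F x * U x
          ∂((pinnedChain ω₂ lam β γ).gibbsMeasure N T) =
        -∫ x, F x * (γ / (2 * T ^ 2) * (x.2 ⟨0, by omega⟩ ^ 2 - x.2 ⟨N - 1, by omega⟩ ^ 2))
          ∂((pinnedChain ω₂ lam β γ).gibbsMeasure N T))
    (hE' : ∀ F : PhaseSpace N → ℝ, ContDiff ℝ ∞ F → HasCompactSupport F →
      ∫ x, (pinnedChain ω₂ lam β γ).flipGenerator N T T ε' F x * U' x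
          ∂((pinnedChain ω₂ lam β γ).gibbsMeasure N T) =
        -∫ x, F x * (γ / (2 * T ^ 2) * (x.2 ⟨0, by omega⟩ ^ 2 - x.2 ⟨N - 1, by omega⟩ ^ 2))
          ∂((pinnedChain ω₂ lam β γ).gibbsMeasure N T)) :
    |(∫ x, (∑ i : Fin N, (pinnedChain ω₂ lam β γ).bondCurrent N i x) * U x
        ∂((pinnedChain ω₂ lam β γ).gibbsMeasure N T)) -
      ∫ x, (∑ i : Fin N, (pinnedChain ω₂ lam β γ).bondCurrent N i x) * U' x
        ∂((pinnedChain ω₂ lam β γ).gibbsMeasure N T)| ≤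
      |ε - ε'| * ((N : ℝ) - 1) * T ^ 2 *
        Real.sqrt ((1 / 2) * ∑ i : Fin N, ∫ x, (U x - U (momentumFlip i x)) ^ 2
          ∂((pinnedChain ω₂ lam β γ).gibbsMeasure N T)) *
        Real.sqrt ((1 / 2) * ∑ i : Fin N, ∫ x, (U' x - U' (momentumFlip i x)) ^ 2
          ∂((pinnedChain ω₂ lam β γ).gibbsMeasure N T)) := by
  set P := pinnedChain ω₂ lam β γ with hP
  set π := P.gibbsMeasure N T with hπ_def
  haveI : IsProbabilityMeasure π := pinnedChain_isProbabilityMeasure_gibbsMeasure hω hl hβ.le γ N hT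
  have hU1 := pinnedChain_contDiff_U ω₂ lam β γ (n := 1)
  have hV1 := pinnedChain_contDiff_V ω₂ lam β γ (n := 1)
  have hΘi : ∀ i : Fin N, MeasurePreserving (momentumFlip i) π π := fun i =>
    P.measurePreserving_momentumFlip_gibbsMeasure N T i
  have hΘ : MeasurePreserving (momentumReversal N) π π :=
    OddResponseBound.DensityUnique.measurePreserving_momentumReversal_gibbsMeasure P N T
  -- the McLennan data
  set c : ℝ := ((N : ℝ) - 1) * T ^ 2 with hc
  set Ψ : PhaseSpace N → ℝ := fun y => (((N : ℝ) - 1) * T ^ 2)⁻¹ * energyMoment P N y +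
    (-(2 * T ^ 2)⁻¹) * P.hamiltonian N y with hΨ
  set φ : PhaseSpace N → ℝ := fun x => γ / (2 * T ^ 2) * (x.2 ⟨0, by omega⟩ ^ 2 - x.2 ⟨N - 1, by omega⟩ ^ 2)
    with hφ
  set J : PhaseSpace N → ℝ := fun x => ∑ i : Fin N, P.bondCurrent N i x with hJ
  set W : PhaseSpace N → ℝ := fun x => U x - U' x with hW
  have hc0 : 0 < c := by
    have h2 : (2 : ℝ) ≤ N := by exact_mod_cast hN
    have h1 : 0 < (N : ℝ) - 1 := by linarith
    positivity
  have hLΨ : ∀ x, P.generator N T T Ψ x = c⁻¹ * J x + φ x := fun x =>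
    pinnedChain_generator_mclennanPotential hN T hT.ne' x
  have hφΘ : ∀ x : PhaseSpace N, φ (x.1, -x.2) = φ x := fun x => by
    simp only [hφ, Pi.neg_apply, neg_sq]
  -- `L²` memberships
  have hΨm : MemLp Ψ 2 π := memLp_mclennanPotential hω hl hβ hT N
  have hLΨm : MemLp (P.generator N T T Ψ) 2 π := memLp_generator_mclennanPotential hω hl hβ hT hN
  have hφm : MemLp φ 2 π := memLp_mclennanSource hω hl hβ hT _ _
  have hJm : MemLp J 2 π := memLp_totalCurrent hω hl hβ hT N
  have hSUm : MemLp (flipNoise N U) 2 π := memLp_flipNoise hΘi hUm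
  have hSU'm : MemLp (flipNoise N U') 2 π := memLp_flipNoise hΘi hU'm
  have hWm : MemLp W 2 π := hUm.sub hU'm
  have hw₂m : MemLp (fun x => -ε * flipNoise N U x + ε' * flipNoise N U' x) 2 π :=
    (hSUm.const_mul (-ε)).add (hSU'm.const_mul ε')
  have ham : MemLp (fun x : PhaseSpace N => U' (x.1, -x.2)) 2 π := hU'm.comp_measurePreserving hΘ
  have hSU'Θm : MemLp (fun x : PhaseSpace N => flipNoise N U' (x.1, -x.2)) 2 π :=
    hSU'm.comp_measurePreserving hΘ
  have hvm : MemLp (fun y : PhaseSpace N => -φ y - ε' * flipNoise N U' (y.1, -y.2)) 2 π :=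
    hφm.neg.sub (hSU'Θm.const_mul ε')
  -- (1) the weak adjoint equations in generator form: `∫ (Lg) V = -∫ g φ - r ∫ g (S V)`
  have hAE : ∀ (r : ℝ) {V : PhaseSpace N → ℝ}, MemLp V 2 π →
      (∀ F : PhaseSpace N → ℝ, ContDiff ℝ ∞ F → HasCompactSupport F →
        ∫ x, P.flipGenerator N T T r F x * V x ∂π = -∫ x, F x * φ x ∂π) →
      ∀ g : PhaseSpace N → ℝ, ContDiff ℝ ∞ g → HasCompactSupport g →
        ∫ x, P.generator N T T g x * V x ∂π =
          -(∫ x, g x * φ x ∂π) - r * ∫ x, g x * flipNoise N V x ∂π := by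
    intro r V hVm hEV g hg hgc
    have hgm : MemLp g 2 π := memLp_of_continuous_hasCompactSupport hg.continuous hgc π 2
    have hg2 : ContDiff ℝ 2 g := hg.of_le (by norm_cast)
    have hLgm : MemLp (P.generator N T T g) 2 π :=
      memLp_of_continuous_hasCompactSupport (P.continuous_generator hU1 hV1 N T T hg2)
        (P.hasCompactSupport_generator N T T hg2 hgc) π 2
    have hVΘi : ∀ i : Fin N, MemLp (fun x => V (momentumFlip i x)) 2 π := fun i =>
      hVm.comp_measurePreserving (hΘi i)
    have h1 := hEV g hg hgc
    have iLV : Integrable (fun x => P.generator N T T g x * V x) π := hLgm.integrable_mul hVm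
    have iSg : Integrable (fun x => flipNoise N g x * V x) π :=
      (memLp_flipNoise hΘi hgm).integrable_mul hVm
    have hsplit : ∫ x, P.flipGenerator N T T r g x * V x ∂π =
        (∫ x, P.generator N T T g x * V x ∂π) + r * ∫ x, flipNoise N g x * V x ∂π := by
      rw [← integral_const_mul, ← integral_add iLV (iSg.const_mul r)]
      exact integral_congr_ae (Eventually.of_forall fun x => by
        simp only [OscillatorChain.flipGenerator_eq_add_flipNoise]
        ring)
    have hsym : ∫ x, flipNoise N g x * V x ∂π = ∫ x, g x * flipNoise N V x ∂π :=
      (integral_mul_flipNoise hΘi (hgm.integrable_mul hVm) fun i => hgm.integrable_mul (hVΘi i)).symm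
    rw [hsplit, hsym] at h1
    linarith
  -- (2) the tested relation for `W`: `∫ (LF) W = ∫ F w₂`, `w₂ = -ε S U + ε' S U'`
  have hEW : ∀ F : PhaseSpace N → ℝ, ContDiff ℝ ∞ F → HasCompactSupport F →
      ∫ x, P.generator N T T F x * W x ∂π =
        ∫ x, F x * (-ε * flipNoise N U x + ε' * flipNoise N U' x) ∂π := by
    intro F hF hFc
    have hFm : MemLp F 2 π := memLp_of_continuous_hasCompactSupport hF.continuous hFc π 2
    have hF2 : ContDiff ℝ 2 F := hF.of_le (by norm_cast)
    have hLFm : MemLp (P.generator N T T F) 2 π :=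
      memLp_of_continuous_hasCompactSupport (P.continuous_generator hU1 hV1 N T T hF2)
        (P.hasCompactSupport_generator N T T hF2 hFc) π 2
    have iLU : Integrable (fun x => P.generator N T T F x * U x) π := hLFm.integrable_mul hUm
    have iLU' : Integrable (fun x => P.generator N T T F x * U' x) π := hLFm.integrable_mul hU'm
    have iFS : Integrable (fun x => F x * flipNoise N U x) π := hFm.integrable_mul hSUm
    have iFS' : Integrable (fun x => F x * flipNoise N U' x) π := hFm.integrable_mul hSU'm
    have h1 := hAE ε hUm hE F hF hFc
    have h2 := hAE ε' hU'm hE' F hF hFc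
    have e : ∫ x, P.generator N T T F x * W x ∂π =
        (∫ x, P.generator N T T F x * U x ∂π) - ∫ x, P.generator N T T F x * U' x ∂π := by
      rw [← integral_sub iLU iLU']
      exact integral_congr_ae (Eventually.of_forall fun x => by simp only [hW]; ring)
    have e2 : ∫ x, F x * (-ε * flipNoise N U x + ε' * flipNoise N U' x) ∂π =
        -ε * (∫ x, F x * flipNoise N U x ∂π) + ε' * ∫ x, F x * flipNoise N U' x ∂π := by
      rw [← integral_const_mul, ← integral_const_mul, ← integral_add (iFS.const_mul _) (iFS'.const_mul _)]
      exact integral_congr_ae (Eventually.of_forall fun x => by ring)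
    rw [e, e2, h1, h2]
    ring
  -- (3a) closure at the weak pair `(Ψ, LΨ)`: `c⁻¹ ∫ J W + ∫ φ W = ∫ Ψ w₂ = 0`
  have hA := integral_eq_of_weak_pair hω hl hβ.le hγ hN hT hΨm hLΨm
    (fun g hg hgc => weakPair_mclennanPotential ω₂ lam β γ N hT.ne' hg hgc) hWm hw₂m hEW
  have hΨS : ∀ {V : PhaseSpace N → ℝ}, MemLp V 2 π → ∫ x, Ψ x * flipNoise N V x ∂π = 0 := by
    intro V hVm
    have hVΘi : ∀ i : Fin N, MemLp (fun x => V (momentumFlip i x)) 2 π := fun i =>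
      hVm.comp_measurePreserving (hΘi i)
    have h := integral_mul_flipNoise hΘi (hΨm.integrable_mul hVm) fun i => hΨm.integrable_mul (hVΘi i)
    rw [h]
    have e : (fun x => flipNoise N Ψ x * V x) = fun _ => 0 := by
      funext x
      rw [hΨ, flipNoise_mclennanPotential, zero_mul]
    rw [e, integral_zero]
  have hA0 : ∫ x, Ψ x * (-ε * flipNoise N U x + ε' * flipNoise N U' x) ∂π = 0 := by
    have iS : Integrable (fun x => Ψ x * flipNoise N U x) π := hΨm.integrable_mul hSUm
    have iS' : Integrable (fun x => Ψ x * flipNoise N U' x) π := hΨm.integrable_mul hSU'm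
    calc ∫ x, Ψ x * (-ε * flipNoise N U x + ε' * flipNoise N U' x) ∂π
        = -ε * (∫ x, Ψ x * flipNoise N U x ∂π) + ε' * ∫ x, Ψ x * flipNoise N U' x ∂π := by
          rw [← integral_const_mul, ← integral_const_mul, ← integral_add (iS.const_mul _) (iS'.const_mul _)]
          exact integral_congr_ae (Eventually.of_forall fun x => by ring)
      _ = 0 := by rw [hΨS hUm, hΨS hU'm]; ring
  have iJW : Integrable (fun x => J x * W x) π := hJm.integrable_mul hWm
  have iφW : Integrable (fun x => φ x * W x) π := hφm.integrable_mul hWm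
  have hJW : ∫ x, J x * W x ∂π = -c * ∫ x, φ x * W x ∂π := by
    have e : ∫ x, P.generator N T T Ψ x * W x ∂π = c⁻¹ * (∫ x, J x * W x ∂π) + ∫ x, φ x * W x ∂π := by
      rw [← integral_const_mul, ← integral_add (iJW.const_mul c⁻¹) iφW]
      exact integral_congr_ae (Eventually.of_forall fun x => by simp only [hLΨ]; ring)
    rw [e, hA0] at hA
    have hcc : c * c⁻¹ = 1 := mul_inv_cancel₀ hc0.ne'
    calc ∫ x, J x * W x ∂π = (c * c⁻¹) * ∫ x, J x * W x ∂π := by rw [hcc, one_mul]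
      _ = c * (c⁻¹ * ∫ x, J x * W x ∂π) := by ring
      _ = c * (-∫ x, φ x * W x ∂π) := by
          rw [show c⁻¹ * ∫ x, J x * W x ∂π = -∫ x, φ x * W x ∂π by linarith]
      _ = -c * ∫ x, φ x * W x ∂π := by ring
  -- (3b) closure at the weak pair `(U'∘Θ, -φ - ε' (S U')∘Θ)`: `∫ φ W = (ε - ε') ∫ (U'∘Θ)(S U)`
  have huv : ∀ g : PhaseSpace N → ℝ, ContDiff ℝ ∞ g → HasCompactSupport g →
      ∫ x, P.generator N T T g x * (fun y : PhaseSpace N => U' (y.1, -y.2)) (x.1, -x.2) ∂π =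
        ∫ x, g x * (fun y : PhaseSpace N => -φ y - ε' * flipNoise N U' (y.1, -y.2)) (x.1, -x.2) ∂π := by
    intro g hg hgc
    have h := hAE ε' hU'm hE' g hg hgc
    have hgm : MemLp g 2 π := memLp_of_continuous_hasCompactSupport hg.continuous hgc π 2
    have e1 : ∀ x : PhaseSpace N, (fun y : PhaseSpace N => U' (y.1, -y.2)) (x.1, -x.2) = U' x := fun x => by
      simp
    have e2 : ∀ x : PhaseSpace N, (fun y : PhaseSpace N => -φ y - ε' * flipNoise N U' (y.1, -y.2)) (x.1, -x.2) =
        -φ x - ε' * flipNoise N U' x := fun x => by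
      simp only [neg_neg, Prod.mk.eta, hφΘ]
    have iφ : Integrable (fun x => g x * φ x) π := hgm.integrable_mul hφm
    have iS : Integrable (fun x => g x * flipNoise N U' x) π := hgm.integrable_mul hSU'm
    have eR : ∫ x, g x * (-φ x - ε' * flipNoise N U' x) ∂π =
        -(∫ x, g x * φ x ∂π) - ε' * ∫ x, g x * flipNoise N U' x ∂π := by
      have e0 : ∫ x, g x * (-φ x - ε' * flipNoise N U' x) ∂π =
          ∫ x, -(g x * φ x + ε' * (g x * flipNoise N U' x)) ∂π :=
        integral_congr_ae (Eventually.of_forall fun x => by ring)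
      rw [e0, integral_neg, integral_add iφ (iS.const_mul _), integral_const_mul]
      ring
    simp only [e1, e2]
    rw [eR]
    exact h
  have hB := integral_eq_of_weak_pair hω hl hβ.le hγ hN hT ham hvm huv hWm hw₂m hEW
  have iaSU : Integrable (fun x : PhaseSpace N => U' (x.1, -x.2) * flipNoise N U x) π :=
    ham.integrable_mul hSUm
  have iaSU' : Integrable (fun x : PhaseSpace N => U' (x.1, -x.2) * flipNoise N U' x) π :=
    ham.integrable_mul hSU'm
  -- `∫ (S U')(Θx) W x = ∫ S(U'∘Θ) W = ∫ (U'∘Θ) (S W) = ∫ (U'∘Θ)(S U) - ∫ (U'∘Θ)(S U')`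
  have hSaW : ∫ x, flipNoise N U' (x.1, -x.2) * W x ∂π =
      (∫ x, U' (x.1, -x.2) * flipNoise N U x ∂π) - ∫ x, U' (x.1, -x.2) * flipNoise N U' x ∂π := by
    have haΘi : ∀ i : Fin N, MemLp (fun x => (fun y : PhaseSpace N => U' (y.1, -y.2)) (momentumFlip i x)) 2 π :=
      fun i => ham.comp_measurePreserving (hΘi i)
    have hsym : ∫ x, W x * flipNoise N (fun y : PhaseSpace N => U' (y.1, -y.2)) x ∂π =
        ∫ x, flipNoise N W x * (fun y : PhaseSpace N => U' (y.1, -y.2)) x ∂π :=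
      integral_mul_flipNoise hΘi (hWm.integrable_mul ham) fun i => hWm.integrable_mul (haΘi i)
    have hSW : ∀ x, flipNoise N W x = flipNoise N U x - flipNoise N U' x := fun x => by
      rw [hW]
      exact flipNoise_sub U U' x
    calc ∫ x, flipNoise N U' (x.1, -x.2) * W x ∂π
        = ∫ x, W x * flipNoise N (fun y : PhaseSpace N => U' (y.1, -y.2)) x ∂π :=
          integral_congr_ae (Eventually.of_forall fun x => by simp only [flipNoise_comp_reversal]; ring)
      _ = ∫ x, flipNoise N W x * (fun y : PhaseSpace N => U' (y.1, -y.2)) x ∂π := hsym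
      _ = ∫ x, (U' (x.1, -x.2) * flipNoise N U x - U' (x.1, -x.2) * flipNoise N U' x) ∂π :=
          integral_congr_ae (Eventually.of_forall fun x => by simp only [hSW]; ring)
      _ = _ := integral_sub iaSU iaSU'
  have hY : ∫ x, φ x * W x ∂π = (ε - ε') * ∫ x, U' (x.1, -x.2) * flipNoise N U x ∂π := by
    have iSW : Integrable (fun x : PhaseSpace N => flipNoise N U' (x.1, -x.2) * W x) π :=
      hSU'Θm.integrable_mul hWm
    have e1 : ∫ x, (fun y : PhaseSpace N => -φ y - ε' * flipNoise N U' (y.1, -y.2)) x * W x ∂π =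
        -(∫ x, φ x * W x ∂π) - ε' * ∫ x, flipNoise N U' (x.1, -x.2) * W x ∂π := by
      have e0 : ∫ x, (fun y : PhaseSpace N => -φ y - ε' * flipNoise N U' (y.1, -y.2)) x * W x ∂π =
          ∫ x, -(φ x * W x + ε' * (flipNoise N U' (x.1, -x.2) * W x)) ∂π :=
        integral_congr_ae (Eventually.of_forall fun x => by ring)
      rw [e0, integral_neg, integral_add iφW (iSW.const_mul _), integral_const_mul]
      ring
    have e2 : ∫ x, (fun y : PhaseSpace N => U' (y.1, -y.2)) x * (-ε * flipNoise N U x + ε' * flipNoise N U' x) ∂π =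
        -ε * (∫ x, U' (x.1, -x.2) * flipNoise N U x ∂π) + ε' * ∫ x, U' (x.1, -x.2) * flipNoise N U' x ∂π := by
      rw [← integral_const_mul, ← integral_const_mul, ← integral_add (iaSU.const_mul _) (iaSU'.const_mul _)]
      exact integral_congr_ae (Eventually.of_forall fun x => by ring)
    rw [e1, e2, hSaW] at hB
    linear_combination (-1 : ℝ) * hB
  -- (4) Cauchy–Schwarz in the flip form
  have hCS := abs_integral_mul_flipNoise_le hΘi ham hUm
  rw [flipEnergy_comp_reversal hΘ U'] at hCS
  have iJU : Integrable (fun x => J x * U x) π := hJm.integrable_mul hUm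
  have iJU' : Integrable (fun x => J x * U' x) π := hJm.integrable_mul hU'm
  have hdiff : (∫ x, J x * U x ∂π) - ∫ x, J x * U' x ∂π = ∫ x, J x * W x ∂π := by
    rw [← integral_sub iJU iJU']
    exact integral_congr_ae (Eventually.of_forall fun x => by simp only [hW]; ring)
  rw [hdiff, hJW, hY]
  calc |-c * ((ε - ε') * ∫ x, U' (x.1, -x.2) * flipNoise N U x ∂π)|
      = c * |ε - ε'| * |∫ x, U' (x.1, -x.2) * flipNoise N U x ∂π| := by
        rw [abs_mul, abs_mul, abs_neg, abs_of_pos hc0]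
        ring
    _ ≤ c * |ε - ε'| * (Real.sqrt ((1 / 2) * ∑ i : Fin N, ∫ x, (U x - U (momentumFlip i x)) ^ 2 ∂π) *
          Real.sqrt ((1 / 2) * ∑ i : Fin N, ∫ x, (U' x - U' (momentumFlip i x)) ^ 2 ∂π)) :=
        mul_le_mul_of_nonneg_left hCS (by positivity)
    _ = _ := by rw [hc]; ring

end StubResponseContinuousInNoise

/-- Registered helper sub-goal `helper_duhamelFlipBoundTwoRates` of stub `stub_responseContinuousInNoise` (line
`fekete-transposed-uniformity`, crux stmt-AtomisticToContinuum-11975): **the Duhamel bound in the flip Dirichlet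
form between two flip rates.** For the pinned anharmonic chain (all parameters `> 0`), `T > 0`, any `N`, any two
real flip rates `ε, ε'`, the unique weak steady families `με` of `L + εS` and `με'` of `L + ε'S`, ANY response
densities `Uε, Uε'` of the two families at `T` (square-integrable for the Gibbs measure, representing the
`δ`-derivatives at `0` of `∫ g dμ_{T+δ/2,T−δ/2}` for test `g` and of the total current) and the response
coefficients `Dε, Dε'` (limits of `totalCurrent/δ` along `𝓝[≠] 0`):
`|Dε − Dε'| ≤ |ε − ε'| (N−1) T² √(½∑_i∫(Uε − Uε∘Θ_i)² dμ_T) √(½∑_i∫(Uε' − Uε'∘Θ_i)² dμ_T)`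
(`StubResponseContinuousInNoise.abs_sub_le_of_weak_two` fed with `responseCoeff_eq` and the weak adjoint
equations `integral_flipGenerator_mul_responseDensity_gibbs`; `N ≤ 1`: no current). [folklore] -/
theorem helper_duhamelFlipBoundTwoRates : ∀ ω₂ lam β γ : ℝ, 0 < ω₂ → 0 < lam → 0 < β → 0 < γ → ∀ T : ℝ, 0 < T → ∀ (N : ℕ) (ε ε' : ℝ) (με με' : ℝ → ℝ → MeasureTheory.Measure (Literature.MathematicalPhysics.KineticTheory.HeatConduction.PhaseSpace N)), (∀ T_L T_R : ℝ, 0 < T_L → 0 < T_R → (Literature.MathematicalPhysics.KineticTheory.HeatConduction.pinnedChain ω₂ lam β γ).IsFlipSteadyState N T_L T_R ε (με T_L T_R) ∧ ∀ ν : MeasureTheory.Measure (Literature.MathematicalPhysics.KineticTheory.HeatConduction.PhaseSpace N), (Literature.MathematicalPhysics.KineticTheory.HeatConduction.pinnedChain ω₂ lam β γ).IsFlipSteadyState N T_L T_R ε ν → ν = με T_L T_R) → (∀ T_L T_R : ℝ, 0 < T_L → 0 < T_R → (Literature.MathematicalPhysics.KineticTheory.HeatConduction.pinnedChain ω₂ lam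 β γ).IsFlipSteadyState N T_L T_R ε' (με' T_L T_R) ∧ ∀ ν : MeasureTheory.Measure (Literature.MathematicalPhysics.KineticTheory.HeatConduction.PhaseSpace N), (Literature.MathematicalPhysics.KineticTheory.HeatConduction.pinnedChain ω₂ lam β γ).IsFlipSteadyState N T_L T_R ε' ν → ν = με' T_L T_R) → ∀ Uε Uε' : Literature.MathematicalPhysics.KineticTheory.HeatConduction.PhaseSpace N → ℝ, (MeasureTheory.MemLp Uε 2 ((Literature.MathematicalPhysics.KineticTheory.HeatConduction.pinnedChain ω₂ lam β γ).gibbsMeasure N T) ∧ (∀ g : Literature.MathematicalPhysics.KineticTheory.HeatConduction.PhaseSpace N → ℝ, ContDiff ℝ ((⊤ : ℕ∞) : WithTop ℕ∞) g → HasCompactSupport g → HasDerivAt (fun δ : ℝ => ∫ x, g x ∂(με (T + δ / 2) (T - δ / 2))) (∫ x, g x * Uε x ∂((Literature.MathematicalPhysics.KineticTheory.HeatConduction.pinnedChain ω₂ lam β γ).gibbsMeasure N T)) 0) ∧ HasDerivAt (fun δ : ℝ => (Literature.MathematicalPhysics.KineticTheory.HeatConduction.pinnedChain ω₂ lam β γ).totalCurrent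 (με (T + δ / 2) (T - δ / 2))) (∑ i : Fin N, ∫ x, (Literature.MathematicalPhysics.KineticTheory.HeatConduction.pinnedChain ω₂ lam β γ).bondCurrent N i x * Uε x ∂((Literature.MathematicalPhysics.KineticTheory.HeatConduction.pinnedChain ω₂ lam β γ).gibbsMeasure N T)) 0) → (MeasureTheory.MemLp Uε' 2 ((Literature.MathematicalPhysics.KineticTheory.HeatConduction.pinnedChain ω₂ lam β γ).gibbsMeasure N T) ∧ (∀ g : Literature.MathematicalPhysics.KineticTheory.HeatConduction.PhaseSpace N → ℝ, ContDiff ℝ ((⊤ : ℕ∞) : WithTop ℕ∞) g → HasCompactSupport g → HasDerivAt (fun δ : ℝ => ∫ x, g x ∂(με' (T + δ / 2) (T - δ / 2))) (∫ x, g x * Uε' x ∂((Literature.MathematicalPhysics.KineticTheory.HeatConduction.pinnedChain ω₂ lam β γ).gibbsMeasure N T)) 0) ∧ HasDerivAt (fun δ : ℝ => (Literature.MathematicalPhysics.KineticTheory.HeatConduction.pinnedChain ω₂ lam β γ).totalCurrent (με' (T + δ / 2) (T - δ / 2))) (∑ i : Fin N, ∫ x, (Literature.MathematicalPhysics.KineticTheory.HeatConduction.pinnedChain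 ω₂ lam β γ).bondCurrent N i x * Uε' x ∂((Literature.MathematicalPhysics.KineticTheory.HeatConduction.pinnedChain ω₂ lam β γ).gibbsMeasure N T)) 0) → ∀ Dε Dε' : ℝ, Filter.Tendsto (fun δ : ℝ => (Literature.MathematicalPhysics.KineticTheory.HeatConduction.pinnedChain ω₂ lam β γ).totalCurrent (με (T + δ / 2) (T - δ / 2)) / δ) (nhdsWithin 0 {(0 : ℝ)}ᶜ) (nhds Dε) → Filter.Tendsto (fun δ : ℝ => (Literature.MathematicalPhysics.KineticTheory.HeatConduction.pinnedChain ω₂ lam β γ).totalCurrent (με' (T + δ / 2) (T - δ / 2)) / δ) (nhdsWithin 0 {(0 : ℝ)}ᶜ) (nhds Dε') → |Dε - Dε'| ≤ |ε - ε'| * ((N : ℝ) - 1) * T ^ 2 * Real.sqrt ((1 / 2) * ∑ i : Fin N, ∫ x, (Uε x - Uε (Literature.MathematicalPhysics.KineticTheory.HeatConduction.momentumFlip i x)) ^ 2 ∂((Literature.MathematicalPhysics.KineticTheory.HeatConduction.pinnedChain ω₂ lam β γ).gibbsMeasure N T)) * Real.sqrt ((1 / 2) * ∑ i : Fin N, ∫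 x, (Uε' x - Uε' (Literature.MathematicalPhysics.KineticTheory.HeatConduction.momentumFlip i x)) ^ 2 ∂((Literature.MathematicalPhysics.KineticTheory.HeatConduction.pinnedChain ω₂ lam β γ).gibbsMeasure N T)) := by
  intro ω₂ lam β γ hω hl hβ hγ T hT N ε ε' με με' hμε hμε' Uε Uε' hUε hUε' Dε Dε' hDε hDε'
  obtain ⟨hUεm, hUεg, hUεJ⟩ := hUε
  obtain ⟨hUε'm, hUε'g, hUε'J⟩ := hUε'
  -- the diagonal members are the Gibbs measure
  have hπε : με T T = (pinnedChain ω₂ lam β γ).gibbsMeasure N T :=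
    flipSteadyFamily_eq_gibbsMeasure hω hl.le hβ.le γ hT ε με hμε
  have hπε' : με' T T = (pinnedChain ω₂ lam β γ).gibbsMeasure N T :=
    flipSteadyFamily_eq_gibbsMeasure hω hl.le hβ.le γ hT ε' με' hμε'
  -- the response coefficients as pairings with the total current
  have hD1 := responseCoeff_eq με hπε hUεJ hDε
  have hD2 := responseCoeff_eq με' hπε' hUε'J hDε'
  rcases Nat.lt_or_ge N 2 with hN | hN
  · -- `N ≤ 1`: no current at all
    have hN1 : N ≤ 1 := by omega
    have h0 : Dε = 0 := responseCoeff_eq_zero_of_le_one (pinnedChain ω₂ lam β γ) hN1 με hDε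
    have h0' : Dε' = 0 := responseCoeff_eq_zero_of_le_one (pinnedChain ω₂ lam β γ) hN1 με' hDε'
    rw [h0, h0', sub_zero, abs_zero]
    interval_cases N
    · simp
    · simp
  -- `N ≥ 2`
  haveI : IsProbabilityMeasure ((pinnedChain ω₂ lam β γ).gibbsMeasure N T) :=
    pinnedChain_isProbabilityMeasure_gibbsMeasure hω hl.le hβ.le γ N hT
  -- the weak adjoint equations
  have hEε : ∀ F : PhaseSpace N → ℝ, ContDiff ℝ ∞ F → HasCompactSupport F →
      ∫ x, (pinnedChain ω₂ lam β γ).flipGenerator N T T ε F x * Uε x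
          ∂((pinnedChain ω₂ lam β γ).gibbsMeasure N T) =
        -∫ x, F x * (γ / (2 * T ^ 2) * (x.2 ⟨0, by omega⟩ ^ 2 - x.2 ⟨N - 1, by omega⟩ ^ 2))
          ∂((pinnedChain ω₂ lam β γ).gibbsMeasure N T) := fun F hF hFc =>
    integral_flipGenerator_mul_responseDensity_gibbs hω hl.le hβ.le hN hT ε με
      (fun T_L T_R hL hR => (hμε T_L T_R hL hR).1) hπε hUεg hF hFc
  have hEε' : ∀ F : PhaseSpace N → ℝ, ContDiff ℝ ∞ F → HasCompactSupport F →
      ∫ x, (pinnedChain ω₂ lam β γ).flipGenerator N T T ε' F x * Uε' x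
          ∂((pinnedChain ω₂ lam β γ).gibbsMeasure N T) =
        -∫ x, F x * (γ / (2 * T ^ 2) * (x.2 ⟨0, by omega⟩ ^ 2 - x.2 ⟨N - 1, by omega⟩ ^ 2))
          ∂((pinnedChain ω₂ lam β γ).gibbsMeasure N T) := fun F hF hFc =>
    integral_flipGenerator_mul_responseDensity_gibbs hω hl.le hβ.le hN hT ε' με'
      (fun T_L T_R hL hR => (hμε' T_L T_R hL hR).1) hπε' hUε'g hF hFc
  -- `D = ∫ J U dμ_T`
  have hsum : ∀ U : PhaseSpace N → ℝ, MemLp U 2 ((pinnedChain ω₂ lam β γ).gibbsMeasure N T) →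
      ∑ i : Fin N, ∫ x, (pinnedChain ω₂ lam β γ).bondCurrent N i x * U x ∂((pinnedChain ω₂ lam β γ).gibbsMeasure N T) =
        ∫ x, (∑ i : Fin N, (pinnedChain ω₂ lam β γ).bondCurrent N i x) * U x
          ∂((pinnedChain ω₂ lam β γ).gibbsMeasure N T) := by
    intro U hU
    have hi : ∀ i : Fin N, Integrable (fun x => (pinnedChain ω₂ lam β γ).bondCurrent N i x * U x)
        ((pinnedChain ω₂ lam β γ).gibbsMeasure N T) := fun i =>
      (memLp_bondCurrent_gibbsMeasure hω hl.le hβ.le γ N hT i).integrable_mul hU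
    rw [← integral_finsetSum _ fun i _ => hi i]
    exact integral_congr_ae (Eventually.of_forall fun x => by simp only [Finset.sum_mul])
  rw [hD1, hD2, hsum Uε hUεm, hsum Uε' hUε'm]
  exact StubResponseContinuousInNoise.abs_sub_le_of_weak_two hω hl.le hβ hγ hN hT ε ε' hUεm hUε'm hEε hEε'

end Summit.AtomisticToContinuum.FouriersLaw.Theorems.NoiseLocality

end
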